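import Literature.NumberTheory.EllipticCurves.SelmerFiniteProofs
import Literature.NumberTheory.EllipticCurves.KodairaNeronUnramified
import Literature.NumberTheory.EllipticCurves.ReductionInertiaInvarianceProofs
import Literature.NumberTheory.EllipticCurves.TateModuleInertiaReductionProofs
import Literature.NumberTheory.EllipticCurves.NeronOggShafarevichLocal
import Literature.NumberTheory.EllipticCurves.HasseWeilAbelianConductor
import HarnessLib

/-!
# `(V_ℓ E)^{I_𝔓} = 0` at the additive places, from the Kodaira–Néron finiteness alone
# (Silverman *ATAEC* Thm. IV.10.2(a), additive case; Serre–Tate §1 Lemma 2)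

`Proofs` file (theorems only, no definitions, no named facts) in topic
`NumberTheory/EllipticCurves`, landed by the tenured seat of bsd.S15
(`Literature.NumberTheory.EllipticCurves.conductorNorm_eq_artinConductorNat`, `BSDConductor`).
It proves the named fact
`WeierstrassCurve.codimFixed_inertia_rationalTate_eq_two_of_hasAdditiveReductionAt W ℓ` of
`HasseWeilAbelianConductor` — Silverman, *Advanced Topics in the Arithmetic of Elliptic Curves*,
Thm. IV.10.2(a), additive case: *"`ε(E/K) = 2` if `E` has additive reduction"*, i.e.
`codim (V_ℓ E)^{I_𝔓} = 2` (PDF p. 358 of the held copy) — **from the single named fact of the tree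
that its printed proof needs and that is not proved in either of Silverman's books**, the
Kodaira–Néron finiteness of `E(K^nr)/E₀(K^nr)` (*ATAEC* Cor. IV.9.2(d), *AEC* Cor. VII.6.2),
in the tree's local rendering `WeierstrassCurve.kodairaNeron_exists_finset_reducesToNonsingular`
(`KodairaNeronUnramified`, for the minimal model at `v` and the points of `E(K̄_v)` fixed by the
inertia group `I_𝔐 ≤ Γ_{K_v}`).

The printed proof (PDF p. 359, "taken from Serre–Tate [1]"):
`V_ℓ(E(K^nr)) ≃ V_ℓ(E₀(K^nr)) ≃ V_ℓ(Ẽ_ns(k̄)) = V_ℓ(k̄⁺) = 0`.  The tree had reduced the fact to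
the construction of "reduction data" at `𝔓` (`TateModuleInertiaReductionProofs`,
`codimFixed_inertia_rationalTate_eq_two_of_reduction`: a subgroup `A'` of `E(K̄)^{I_𝔓}` of finite
exponent-index with a homomorphism to `k̄⁺` whose kernel has no `ℓ`-torsion).  This file
constructs these data **inside `K̄_v`** (no maximal unramified extension, no Hensel lift is
needed in the additive case):

* `WeierstrassCurve.exists_addEquiv_localPoints_of_smul_eq` — the `Γ_{K_v}`-equivariant transport
  `E(K̄_v) ≃+ X(K̄_v)` to a model `X = C • E_{K_v}` over `K_v` (here the minimal model,
  `exists_variableChange_smul_eq_localMinimalModel`), as in `SelmerFiniteProofs`;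
* `WeierstrassCurve.spectralValuation_algebraMap_lt_one_of_mem_maximalIdeal`,
  `isometry_of_mem_inertia` — `𝔪_v` has spectral valuation `< 1`; elements of `I_𝔐` are
  isometries moving integers within their residue classes (Neukirch II (9.3));
* `WeierstrassCurve.exists_nsmul_hasNonsingularReduction_of_kodairaNeron` — **Kodaira–Néron as an
  exponent**: from the finite set of representatives of the named fact, a `c ≠ 0` with
  `c • P ∈ E₀` for every `I_𝔐`-fixed `P ∈ X(K̄_v)` (`E₀` of an `𝒪_w`-model `W₀` with
  `X_{K̄_v} = (W₀)_{K̄_v}`, `ReductionHomomorphism`; the index of `E₀ ∩ Fix` in `Fix` is finite);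
* `WeierstrassCurve.codimFixed_inertia_rationalTate_eq_two_of_hasAdditiveReductionAt_of_kodairaNeron_primeBelow`,
  `…_at`, and **`…_of_kodairaNeron : (∀ v, Kodaira–Néron at v) → the named fact`** — the
  assembly: `A' = F⁻¹(E₀)` for the injection `F = (W₀-transport) ∘ Φ ∘ ι_*` of `E(K̄)^{I_𝔓}` into
  `X(K̄_v)` (`ι : K̄ → K̄_v` with `𝔓 = 𝔓_{ι,𝔐}`, `pointsMapOfEmb`; local inertia restricts into
  `I_𝔓`, `resGalOfEmb_mem_inertia_primeBelow`, so `F` lands in the `I_𝔐`-fixed points),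
  `r = ` reduction to `Ẽ_ns(k̄) ≅ k̄⁺` (`exists_addMonoidHom_residueField_of_cusp`, the reduction
  of the minimal model being a cusp by `HasAdditiveReduction`), kernel `= E₁` without
  `ℓ`-torsion (`ReducesToZero.eq_zero_of_zsmul_eq_zero`, *AEC* VII.3.1), and
  `codimFixed_inertia_rationalTate_eq_two_of_reduction`; every prime `𝔓 ∣ v` is a `𝔓_{ι,𝔐}`
  (`exists_smul_eq_of_mem_primesAbove_holds`, `primeBelow_comp`).

So after this file the additive tame leaf under bsd.S15 / the Serre–Tate codimension facts / the
criterion of Néron–Ogg–Shafarevich (`neronOggShafarevich_of_codimFixed_facts`) rests on the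
Kodaira–Néron named fact alone; the multiplicative leaf is the sibling
`InertiaInvariantsKodairaNeronMultiplicativeProofs` (in preparation).

All axioms `propext`, `Classical.choice`, `Quot.sound`.

## References

* J. H. Silverman, *Advanced Topics in the Arithmetic of Elliptic Curves*, GTM 151 (1994), §IV.10,
  Thm. 10.2(a) and its proof (PDF pp. 358–359); Cor. IV.9.2(d). [SilvermanATAEC1994]
* J.-P. Serre, J. Tate, *Good reduction of abelian varieties*, Ann. of Math. 88 (1968), §1,
  Lemmas 1–2. [SerreTate1968]
* J. H. Silverman, *The Arithmetic of Elliptic Curves*, 2nd ed. (2009), VII.2.1, VII.3.1,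
  VII.5.1(c), Cor. VII.6.2. [SilvermanAEC2009]
* J. Neukirch, *Algebraic Number Theory* (1999), Ch. II (4.8), (6.2), §9 (9.3), (9.6).
  [NeukirchANT1999]

## Design

No definitions (the subgroups `Fix(I_𝔐)`, `E₀`, `A'` and the maps `F`, `r` are built inside the
proofs from Mathlib's `AddSubgroup.comap` / `AddMonoidHom.codRestrict`); `noncomputable section`;
`open scoped Classical NNReal Pointwise`; one universe `u` (`K : Type u`, forced by `Sha`).  The
spectral valuation is quantified with its defining property `hw` as in `SelmerFiniteProofs`.
-/

noncomputable section

open scoped Classical NNReal Pointwise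
open NumberField IsDedekindDomain

universe u

namespace WeierstrassCurve

open Literature.NumberTheory.EllipticCurves Literature.NumberTheory.GaloisRepresentations Field
  IsDedekindDomain.HeightOneSpectrum

variable {K : Type u} [Field K] [NumberField K] (W : WeierstrassCurve K) (v : HeightOneSpectrum (𝓞 K))

/-- **Equivariant transport to a model over `K_v`.**  For a Weierstrass equation `X` over `K_v`
with `X = C • E_{K_v}` there is an additive isomorphism `Φ : E(K̄_v) ≃+ X(K̄_v)` (the change of
variables, `VariableChange.pointEquivBaseChange`, between two identity transports) with
`Φ(P^σ) = Φ(P)^σ` for every `σ ∈ Γ_{K_v}` (`C` has coefficients in `K_v`).  Silverman, *AEC*,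
VII.§1 and VIII.§1; the construction of `SelmerFiniteProofs.smul_localPoints_eq_of_mem_inertia_holds`.
[cite: SilvermanAEC2009, VII.§1 and VIII.§1 (changes of variables over the ground field commute with Galois)] -/
theorem exists_addEquiv_localPoints_of_smul_eq {X : WeierstrassCurve (v.adicCompletion K)}
    {C : VariableChange (v.adicCompletion K)} (hCM : C • W.baseChange (v.adicCompletion K) = X) :
    ∃ Φ : localPoints W (v.adicCompletion K) ≃+
        (X.baseChange (AlgebraicClosure (v.adicCompletion K))).toAffine.Point,
      ∀ (σ : absoluteGaloisGroup (v.adicCompletion K)) (Q : localPoints W (v.adicCompletion K)),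
        Φ (σ • Q) = Affine.Point.map ((absoluteGaloisGroup.toAlgEquiv _ σ :
            AlgebraicClosure (v.adicCompletion K) ≃ₐ[v.adicCompletion K]
              AlgebraicClosure (v.adicCompletion K)) :
            AlgebraicClosure (v.adicCompletion K) →ₐ[v.adicCompletion K]
              AlgebraicClosure (v.adicCompletion K)) (Φ Q) := by
  have hCM' := congrArg (fun Y : WeierstrassCurve (v.adicCompletion K) ↦
    Y.baseChange (AlgebraicClosure (v.adicCompletion K))) hCM
  let Φ : localPoints W (v.adicCompletion K) ≃+
      (X.baseChange (AlgebraicClosure (v.adicCompletion K))).toAffine.Point :=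
    ((Affine.Point.congrEquiv (baseChange_baseChange_adicCompletion W v).symm).trans
      (VariableChange.pointEquivBaseChange (W.baseChange (v.adicCompletion K)) C
        (AlgebraicClosure (v.adicCompletion K)))).trans
      (Affine.Point.congrEquiv hCM')
  refine ⟨Φ, fun σ Q ↦ ?_⟩
  change Affine.Point.congrEquiv hCM' (VariableChange.pointEquivBaseChange
      (W.baseChange (v.adicCompletion K)) C (AlgebraicClosure (v.adicCompletion K))
      (Affine.Point.congrEquiv (baseChange_baseChange_adicCompletion W v).symm (σ • Q))) =
    Affine.Point.map ((absoluteGaloisGroup.toAlgEquiv _ σ :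
        AlgebraicClosure (v.adicCompletion K) ≃ₐ[v.adicCompletion K]
          AlgebraicClosure (v.adicCompletion K)) :
        AlgebraicClosure (v.adicCompletion K) →ₐ[v.adicCompletion K]
          AlgebraicClosure (v.adicCompletion K)) (Affine.Point.congrEquiv hCM'
      (VariableChange.pointEquivBaseChange (W.baseChange (v.adicCompletion K)) C
        (AlgebraicClosure (v.adicCompletion K))
        (Affine.Point.congrEquiv (baseChange_baseChange_adicCompletion W v).symm Q)))
  rw [congrEquiv_smul, VariableChange.pointEquivBaseChange_map_algEquiv]
  exact Affine.Point.congrEquiv_baseChange_map hCM _ _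

/-- The local minimal model at `v` is `C • E_{K_v}` for some change of variables `C` over `K_v`
(by its definition through Mathlib's `WeierstrassCurve.minimal`). [folklore] -/
theorem exists_variableChange_smul_eq_localMinimalModel :
    ∃ C : VariableChange (v.adicCompletion K),
      C • W.baseChange (v.adicCompletion K) = W.localMinimalModel v :=
  ⟨_, rfl⟩

section Local

variable {v} {w : Valuation (AlgebraicClosure (v.adicCompletion K)) ℝ≥0}
  (hw : ∀ x, (w x : ℝ) = spectralNorm (v.adicCompletion K) (AlgebraicClosure (v.adicCompletion K)) x)
include hw

omit W in
/-- Elements of `𝔪_v ⊆ 𝓞_v` have spectral valuation `< 1` in `K̄_v` (through a prime `𝔐` of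
`\\bar 𝓞_v` above `𝓂_v`: `𝔐 = {|·|_v < 1}`, `mem_iff_spectralValuation_lt_one`). [folklore] -/
theorem spectralValuation_algebraMap_lt_one_of_mem_maximalIdeal {𝔐 : Ideal v.localAbsIntegers}
    (h𝔐 : 𝔐 ∈ v.localPrimesAbove) {a : v.adicCompletionIntegers K}
    (ha : a ∈ IsLocalRing.maximalIdeal (v.adicCompletionIntegers K)) :
    w (algebraMap (v.adicCompletion K) (AlgebraicClosure (v.adicCompletion K))
      (algebraMap (v.adicCompletionIntegers K) (v.adicCompletion K) a)) < 1 := by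
  haveI := h𝔐.1
  haveI := h𝔐.2
  have hmem : algebraMap (v.adicCompletionIntegers K) v.localAbsIntegers a ∈ 𝔐 := by
    rw [← Ideal.mem_comap, ← Ideal.under_def, ← h𝔐.2.over]
    exact ha
  have hlt := (mem_iff_spectralValuation_lt_one hw h𝔐).mp hmem
  rw [Subalgebra.coe_algebraMap] at hlt
  rwa [← IsScalarTower.algebraMap_apply (v.adicCompletionIntegers K) (v.adicCompletion K)
    (AlgebraicClosure (v.adicCompletion K)) a]

omit W in
/-- **The inertia group, valuation-theoretically**: an element of `I_𝔐 ≤ Γ_{K_v}` is an isometry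
of `K̄_v` for `|·|_v` moving every `|·|_v`-integer within its residue class (Neukirch, *ANT*,
II (9.3); tree `spectralValuation_smul`, `mem_inertia_iff_spectralValuation`). [folklore] -/
theorem isometry_of_mem_inertia {𝔐 : Ideal v.localAbsIntegers} (h𝔐 : 𝔐 ∈ v.localPrimesAbove)
    {τ : absoluteGaloisGroup (v.adicCompletion K)}
    (hτ : τ ∈ 𝔐.inertia (absoluteGaloisGroup (v.adicCompletion K))) :
    (∀ z, w ((absoluteGaloisGroup.toAlgEquiv _ τ :
        AlgebraicClosure (v.adicCompletion K) ≃ₐ[v.adicCompletion K]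
          AlgebraicClosure (v.adicCompletion K)) z) = w z) ∧
      (∀ z, w z ≤ 1 → w ((absoluteGaloisGroup.toAlgEquiv _ τ :
        AlgebraicClosure (v.adicCompletion K) ≃ₐ[v.adicCompletion K]
          AlgebraicClosure (v.adicCompletion K)) z - z) < 1) :=
  ⟨fun z ↦ spectralValuation_smul hw τ z, (mem_inertia_iff_spectralValuation hw h𝔐).mp hτ⟩

end Local

end WeierstrassCurve

namespace WeierstrassCurve

open Literature.NumberTheory.EllipticCurves Literature.NumberTheory.GaloisRepresentations Field
  IsDedekindDomain.HeightOneSpectrum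

variable {K : Type u} [Field K] [NumberField K] {v : HeightOneSpectrum (𝓞 K)}
  {w : Valuation (AlgebraicClosure (v.adicCompletion K)) ℝ≥0}

omit [NumberField K] in
/-- `Literature.NumberTheory.EllipticCurves.ReducesToNonsingular` (the `E₀`-predicate of
`KodairaNeronUnramified`) is invariant under transport along an equality of Weierstrass equations
(identity on coordinates). [folklore] -/
theorem _root_.Literature.NumberTheory.EllipticCurves.reducesToNonsingular_congrEquiv_iff
    {L : Type u} [Field L] {w : Valuation L ℝ≥0}
    {k : Type*} [Field k] (r : w.integer →+* k) {V₁ V₂ : WeierstrassCurve L} (h : V₁ = V₂)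
    (P : V₁.toAffine.Point) :
    ReducesToNonsingular w r (Affine.Point.congrEquiv h P) ↔ ReducesToNonsingular w r P := by
  subst h
  rfl

/-- **Kodaira–Néron as an exponent.**  Let `X/K_v` be an elliptic curve given by an
`𝓞_v`-minimal equation, `w = |·|_v` the spectral valuation of `K̄_v`, `𝔐` the prime of
`\\bar 𝓞_v` above `𝓂_v`, and `W₀` an `𝒪_w`-model with `X_{K̄_v} = (W₀)_{K̄_v}`.  Granted the
Kodaira–Néron named fact for `X` (finitely many classes of `I_𝔐`-fixed points modulo `E₀`;
*ATAEC* Cor. IV.9.2(d), *AEC* Cor. VII.6.2), there is `c ≠ 0` such that `c • P ∈ E₀` (nonsingular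
reduction on `W₀`) for every `I_𝔐`-fixed point `P ∈ X(K̄_v)`: the subgroup of `I_𝔐`-fixed
points with nonsingular reduction has finite index `c` in the group of `I_𝔐`-fixed points (the
finite set of representatives surjects onto the quotient), and `c` kills the quotient.
[cite: SilvermanATAEC1994, Cor. IV.9.2(d) and proof of Thm. IV.10.2(a) (PDF pp. 340, 359)] -/
theorem exists_nsmul_hasNonsingularReduction_of_kodairaNeron
    {X : WeierstrassCurve (v.adicCompletion K)} [X.IsElliptic]
    [X.IsMinimal (v.adicCompletionIntegers K)]
    (hKN : X.kodairaNeron_exists_finset_reducesToNonsingular)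
    (hw : ∀ x, (w x : ℝ) =
      spectralNorm (v.adicCompletion K) (AlgebraicClosure (v.adicCompletion K)) x)
    {𝔐 : Ideal v.localAbsIntegers} (h𝔐 : 𝔐 ∈ v.localPrimesAbove)
    {W₀ : WeierstrassCurve w.integer}
    (hW₀ : X.baseChange (AlgebraicClosure (v.adicCompletion K)) =
      W₀.baseChange (AlgebraicClosure (v.adicCompletion K))) :
    ∃ c : ℕ, c ≠ 0 ∧ ∀ P : (X.baseChange (AlgebraicClosure (v.adicCompletion K))).toAffine.Point,
      (∀ σ ∈ 𝔐.inertia (absoluteGaloisGroup (v.adicCompletion K)),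
        Affine.Point.map ((absoluteGaloisGroup.toAlgEquiv _ σ :
            AlgebraicClosure (v.adicCompletion K) ≃ₐ[v.adicCompletion K]
              AlgebraicClosure (v.adicCompletion K)) :
            AlgebraicClosure (v.adicCompletion K) →ₐ[v.adicCompletion K]
              AlgebraicClosure (v.adicCompletion K)) P = P) →
        W₀.HasNonsingularReduction (Affine.Point.congrEquiv hW₀ (c • P)) := by
  have hv0 : w.Integers w.integer := Valuation.integer.integers w
  obtain ⟨T, hTfix, hT⟩ := hKN w hw h𝔐
  -- the subgroup of inertia-fixed points and its subgroup of points with nonsingular reduction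
  let Gfix : AddSubgroup (X.baseChange (AlgebraicClosure (v.adicCompletion K))).toAffine.Point :=
    { carrier := {P | ∀ σ ∈ 𝔐.inertia (absoluteGaloisGroup (v.adicCompletion K)),
        Affine.Point.map ((absoluteGaloisGroup.toAlgEquiv _ σ :
            AlgebraicClosure (v.adicCompletion K) ≃ₐ[v.adicCompletion K]
              AlgebraicClosure (v.adicCompletion K)) :
            AlgebraicClosure (v.adicCompletion K) →ₐ[v.adicCompletion K]
              AlgebraicClosure (v.adicCompletion K)) P = P}
      zero_mem' := fun σ _ ↦ map_zero _
      add_mem' := fun {P Q} hP hQ σ hσ ↦ by rw [map_add, hP σ hσ, hQ σ hσ]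
      neg_mem' := fun {P} hP σ hσ ↦ by rw [map_neg, hP σ hσ] }
  let E₀ : AddSubgroup (X.baseChange (AlgebraicClosure (v.adicCompletion K))).toAffine.Point :=
    (W₀.nonsingularReductionSubgroup hv0).comap
      (Affine.Point.congrEquiv hW₀).toAddMonoidHom
  let N : AddSubgroup Gfix := E₀.addSubgroupOf Gfix
  have hmemE₀ : ∀ P : (X.baseChange (AlgebraicClosure (v.adicCompletion K))).toAffine.Point,
      P ∈ E₀ ↔ W₀.HasNonsingularReduction (Affine.Point.congrEquiv hW₀ P) := fun P ↦ Iff.rfl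
  -- the quotient is finite: the finite set `T` of Kodaira–Néron surjects onto it
  haveI : Finite (Gfix ⧸ N) := by
    refine Finite.of_surjective
      (fun t : T ↦ (QuotientAddGroup.mk (⟨t.1, hTfix t.1 t.2⟩ : Gfix) : Gfix ⧸ N)) ?_
    intro q
    obtain ⟨P, rfl⟩ := QuotientAddGroup.mk_surjective q
    obtain ⟨t, ht, hPt⟩ := hT P.1 P.2
    refine ⟨⟨t, ht⟩, ?_⟩
    rw [QuotientAddGroup.eq, AddSubgroup.mem_addSubgroupOf, hmemE₀]
    have h1 : ((-(⟨t, hTfix t ht⟩ : Gfix) + P : Gfix) :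
        (X.baseChange (AlgebraicClosure (v.adicCompletion K))).toAffine.Point) = P.1 - t := by
      rw [AddSubgroup.coe_add, AddSubgroup.coe_neg, neg_add_eq_sub]
    rw [h1]
    exact (reducesToNonsingular_iff_hasNonsingularReduction W₀ _).mp
      ((reducesToNonsingular_congrEquiv_iff _ hW₀ _).mpr hPt)
  refine ⟨N.index, AddSubgroup.index_ne_zero_of_finite, fun P hP ↦ ?_⟩
  have hmem := AddSubgroup.nsmul_index_mem N ⟨P, hP⟩
  rw [AddSubgroup.mem_addSubgroupOf, hmemE₀, AddSubgroup.coe_nsmul] at hmem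
  exact hmem


/-! ### Thm. IV.10.2(a), additive case, from Kodaira–Néron -/

variable (W : WeierstrassCurve K) (ℓ : ℕ) [Fact ℓ.Prime]

/-- **Silverman *ATAEC* Thm. IV.10.2(a), additive case, from Kodaira–Néron — at the prime cut
out by an embedding.**  For an elliptic curve `E/K` over a number field, a prime `ℓ`, a place
`v ∤ ℓ` of additive reduction, a `K`-embedding `ι : K̄ → K̄_v` and the prime `𝔐` of `\\bar 𝓞_v`
above `𝓂_v`: granted Kodaira–Néron for the minimal model at `v`,
`codim (V_ℓ E)^{I_{𝔓_{ι,𝔐}}} = 2`.  Proof in the module docstring (reduction data inside `K̄_v`: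
`A' = F⁻¹(E₀)`, exponent from Kodaira–Néron, `r` = reduction to `k̄⁺`, kernel `E₁` without
`ℓ`-torsion; `codimFixed_inertia_rationalTate_eq_two_of_reduction`).
[cite: SilvermanATAEC1994, Thm. IV.10.2(a), additive case, and its proof (PDF pp. 358–359)]
[cite: SerreTate1968, §1 Lemma 2] -/
theorem codimFixed_inertia_rationalTate_eq_two_of_hasAdditiveReductionAt_of_kodairaNeron_primeBelow
    [W.IsElliptic]
    (hKN : (W.localMinimalModel v).kodairaNeron_exists_finset_reducesToNonsingular)
    (h : Continuous fun x : absoluteGaloisGroup K × RationalTateModule (geomPoints W) ℓ ↦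
      rationalTateRepresentation (absoluteGaloisGroup K) (geomPoints W) ℓ x.1 x.2)
    (hℓ : (ℓ : 𝓞 K) ∉ v.asIdeal) (hadd : W.HasAdditiveReductionAt v)
    (ι : AlgebraicClosure K →ₐ[K] AlgebraicClosure (v.adicCompletion K))
    {𝔐 : Ideal v.localAbsIntegers} (h𝔐 : 𝔐 ∈ v.localPrimesAbove) :
    (rationalTateGaloisRepOf (geomPoints W) ℓ h).codimFixed
      ((v.primeBelow ι 𝔐).inertia (absoluteGaloisGroup K)) = 2 := by
  obtain ⟨w, hw⟩ := v.exists_spectralValuation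
  have hv0 : w.Integers w.integer := Valuation.integer.integers w
  -- the minimal model `X` at `v`, its integral model `M` over `𝓞_v`, and a `w`-integral model `W₀`
  haveI : (W.localMinimalModel v).IsElliptic := W.isElliptic_localMinimalModel v
  have hint : ((W.localMinimalModel v).baseChange (AlgebraicClosure (v.adicCompletion K))).IsIntegral
      w.integer := by
    have := isIntegral_spectralValuation_baseChange hw
      ((W.localMinimalModel v).integralModel (v.adicCompletionIntegers K))
    rwa [show ((W.localMinimalModel v).integralModel (v.adicCompletionIntegers K)).map
        (algebraMap (v.adicCompletionIntegers K) (v.adicCompletion K)) = W.localMinimalModel v from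
      baseChange_integralModel_eq (v.adicCompletionIntegers K) (W.localMinimalModel v)] at this
  obtain ⟨W₀, hW₀⟩ := hint.integral
  -- the reduction of `W₀` is a cusp
  have hcoef : ∀ {a : v.adicCompletionIntegers K} (b : w.integer),
      algebraMap w.integer (AlgebraicClosure (v.adicCompletion K)) b =
        algebraMap (v.adicCompletion K) (AlgebraicClosure (v.adicCompletion K))
          (algebraMap (v.adicCompletionIntegers K) (v.adicCompletion K) a) →
      IsDedekindDomain.HeightOneSpectrum.valuation (v.adicCompletion K)
          (IsDiscreteValuationRing.maximalIdeal (v.adicCompletionIntegers K))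
          (algebraMap (v.adicCompletionIntegers K) (v.adicCompletion K) a) < 1 →
      IsLocalRing.residue w.integer b = 0 := by
    intro a b hab hlt
    have hmem : a ∈ IsLocalRing.maximalIdeal (v.adicCompletionIntegers K) :=
      (IsDedekindDomain.HeightOneSpectrum.valuation_lt_one_iff_mem _ a).mp hlt
    rw [← v_algebraMap_lt_one_iff hv0, hab]
    exact spectralValuation_algebraMap_lt_one_of_mem_maximalIdeal hw h𝔐 hmem
  have hΔ : IsLocalRing.residue w.integer W₀.Δ = 0 := by
    refine hcoef (a := ((W.localMinimalModel v).integralModel (v.adicCompletionIntegers K)).Δ)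
      W₀.Δ ?_ ?_
    · rw [integralModel_Δ_eq, ← map_Δ, ← map_Δ]
      change (W₀.baseChange (AlgebraicClosure (v.adicCompletion K))).Δ =
        ((W.localMinimalModel v).baseChange (AlgebraicClosure (v.adicCompletion K))).Δ
      rw [hW₀]
    · rw [integralModel_Δ_eq]; exact hadd.badReduction
  have hc₄ : IsLocalRing.residue w.integer W₀.c₄ = 0 := by
    refine hcoef (a := ((W.localMinimalModel v).integralModel (v.adicCompletionIntegers K)).c₄)
      W₀.c₄ ?_ ?_
    · rw [integralModel_c₄_eq, ← map_c₄, ← map_c₄]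
      change (W₀.baseChange (AlgebraicClosure (v.adicCompletion K))).c₄ =
        ((W.localMinimalModel v).baseChange (AlgebraicClosure (v.adicCompletion K))).c₄
      rw [hW₀]
    · rw [integralModel_c₄_eq]; exact hadd.additiveReduction
  obtain ⟨rc, hrc⟩ := W₀.exists_addMonoidHom_residueField_of_cusp hv0 hΔ hc₄
  -- transport of `E(K̄_v)` to `X`, equivariantly, and the exponent of Kodaira–Néron
  obtain ⟨C, hC⟩ := W.exists_variableChange_smul_eq_localMinimalModel v
  obtain ⟨Φ, hΦ⟩ := W.exists_addEquiv_localPoints_of_smul_eq v hC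
  obtain ⟨c, hc, hcE₀⟩ := exists_nsmul_hasNonsingularReduction_of_kodairaNeron hKN hw h𝔐 hW₀
  -- the map `F = transport ∘ Φ ∘ ι_*` on the inertia invariants
  set H := (v.primeBelow ι 𝔐).inertia (absoluteGaloisGroup K) with hH
  let F : FixedPoints.addSubgroup H (geomPoints W) →+
      (W₀.baseChange (AlgebraicClosure (v.adicCompletion K))).toAffine.Point :=
    (Affine.Point.congrEquiv hW₀).toAddMonoidHom.comp
      (Φ.toAddMonoidHom.comp ((pointsMapOfEmb W ι).comp
        (FixedPoints.addSubgroup H (geomPoints W)).subtype))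
  have hFapply : ∀ P : FixedPoints.addSubgroup H (geomPoints W),
      F P = Affine.Point.congrEquiv hW₀ (Φ (pointsMapOfEmb W ι (P : geomPoints W))) := fun _ ↦ rfl
  have hFinj : Function.Injective F := fun P Q hPQ ↦ by
    rw [hFapply, hFapply] at hPQ
    exact Subtype.ext (pointsMapOfEmb_injective W ι (Φ.injective
      ((Affine.Point.congrEquiv hW₀).injective hPQ)))
  have hfixloc : ∀ P : FixedPoints.addSubgroup H (geomPoints W),
      ∀ σ ∈ 𝔐.inertia (absoluteGaloisGroup (v.adicCompletion K)),
        Affine.Point.map ((absoluteGaloisGroup.toAlgEquiv _ σ :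
            AlgebraicClosure (v.adicCompletion K) ≃ₐ[v.adicCompletion K]
              AlgebraicClosure (v.adicCompletion K)) :
            AlgebraicClosure (v.adicCompletion K) →ₐ[v.adicCompletion K]
              AlgebraicClosure (v.adicCompletion K)) (Φ (pointsMapOfEmb W ι (P : geomPoints W))) =
          Φ (pointsMapOfEmb W ι (P : geomPoints W)) := by
    intro P σ hσ
    rw [← hΦ σ, ← pointsMapOfEmb_smul]
    congr 2
    exact P.2 ⟨_, resGalOfEmb_mem_inertia_primeBelow v ι 𝔐 hσ⟩
  let A' : AddSubgroup (FixedPoints.addSubgroup H (geomPoints W)) :=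
    (W₀.nonsingularReductionSubgroup hv0).comap F
  have hA'mem : ∀ P, P ∈ A' ↔ W₀.HasNonsingularReduction (F P) := fun _ ↦ Iff.rfl
  have hA' : ∀ P : FixedPoints.addSubgroup H (geomPoints W), c • P ∈ A' := by
    intro P
    rw [hA'mem, map_nsmul, hFapply, ← map_nsmul]
    exact hcE₀ _ (hfixloc P)
  -- the homomorphism `r : A' → k̄⁺` and its kernel
  let F' : A' →+ W₀.nonsingularReductionSubgroup hv0 :=
    (F.comp A'.subtype).codRestrict _ (fun P ↦ P.2)
  let r : A' →+ AlgebraicClosure (IsLocalRing.ResidueField w.integer) := rc.comp F'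
  have hℓw : w ((ℓ : ℤ) : AlgebraicClosure (v.adicCompletion K)) = 1 :=
    spectralValuation_intCast_eq_one hw (n := (ℓ : ℤ)) (by simpa using hℓ)
  have htf : ∀ P : A', r P = 0 → ℓ • P = 0 → P = 0 := by
    intro P hr0 hℓP
    have h0 : W₀.ReducesToZero (F P) := (hrc (F' P)).mp hr0
    have hℓF : (ℓ : ℤ) • F P = 0 := by
      rw [natCast_zsmul, ← map_nsmul, ← AddSubgroup.coe_nsmul, hℓP, AddSubgroup.coe_zero, map_zero]
    have hF0 : F P = 0 := h0.eq_zero_of_zsmul_eq_zero W₀ hℓw hℓF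
    have hP0 : (P : FixedPoints.addSubgroup H (geomPoints W)) = 0 := hFinj (by rw [hF0, map_zero])
    exact Subtype.ext hP0
  -- `(ℓ : k̄) ≠ 0`
  have hℓk : ((ℓ : ℕ) : AlgebraicClosure (IsLocalRing.ResidueField w.integer)) ≠ 0 := by
    have hℓw' : w (algebraMap w.integer (AlgebraicClosure (v.adicCompletion K)) (ℓ : w.integer)) = 1 := by
      rw [map_natCast]; exact_mod_cast hℓw
    have h1 : IsLocalRing.residue w.integer (ℓ : w.integer) ≠ 0 :=
      (v_algebraMap_eq_one_iff hv0 _).mp hℓw'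
    have := (_root_.map_ne_zero (algebraMap (IsLocalRing.ResidueField w.integer)
      (AlgebraicClosure (IsLocalRing.ResidueField w.integer)))).mpr h1
    simpa using this
  exact W.codimFixed_inertia_rationalTate_eq_two_of_reduction ℓ hℓk h (v.primeBelow ι 𝔐) A' hc hA'
    r htf


/-- **Thm. IV.10.2(a), additive case, from Kodaira–Néron, at every prime `𝔓 ∣ v`** (every such
prime is cut out by an embedding: `Γ_K` is transitive on the primes above `v`,
`exists_smul_eq_of_mem_primesAbove_holds`, and `𝔓_{ι∘τ,𝔐} = τ⁻¹ • 𝔓_{ι,𝔐}`, `primeBelow_comp`).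
[cite: SilvermanATAEC1994, Thm. IV.10.2(a), additive case, and its proof (PDF pp. 358–359)] -/
theorem codimFixed_inertia_rationalTate_eq_two_of_hasAdditiveReductionAt_of_kodairaNeron_at
    [W.IsElliptic]
    (hKN : (W.localMinimalModel v).kodairaNeron_exists_finset_reducesToNonsingular)
    (h : Continuous fun x : absoluteGaloisGroup K × RationalTateModule (geomPoints W) ℓ ↦
      rationalTateRepresentation (absoluteGaloisGroup K) (geomPoints W) ℓ x.1 x.2)
    (hℓ : (ℓ : 𝓞 K) ∉ v.asIdeal) (hadd : W.HasAdditiveReductionAt v)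
    {𝔓 : Ideal (absIntegers (𝓞 K) K)} (h𝔓 : 𝔓 ∈ v.primesAbove) :
    (rationalTateGaloisRepOf (geomPoints W) ℓ h).codimFixed (𝔓.inertia (absoluteGaloisGroup K)) =
      2 := by
  obtain ⟨𝔐, h𝔐⟩ := v.localPrimesAbove_nonempty
  obtain ⟨g, hg⟩ := HeightOneSpectrum.exists_smul_eq_of_mem_primesAbove_holds
    (HeightOneSpectrum.primeBelow_mem_primesAbove
      (ι := closureEmb (K := K) (v.adicCompletion K)) h𝔐) h𝔓
  have h1 : 𝔓 = v.primeBelow ((closureEmb (K := K) (v.adicCompletion K)).comp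
      ((show AlgebraicClosure K ≃ₐ[K] AlgebraicClosure K from g⁻¹) :
        AlgebraicClosure K →ₐ[K] AlgebraicClosure K)) 𝔐 := by
    rw [HeightOneSpectrum.primeBelow_comp, ← hg]
    exact congrArg (· • _) (inv_inv g).symm
  rw [h1]
  exact W.codimFixed_inertia_rationalTate_eq_two_of_hasAdditiveReductionAt_of_kodairaNeron_primeBelow
    ℓ hKN h hℓ hadd _ h𝔐

/-- **The named fact `codimFixed_inertia_rationalTate_eq_two_of_hasAdditiveReductionAt W ℓ`
(Silverman *ATAEC* Thm. IV.10.2(a), additive case) from the Kodaira–Néron finiteness at every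
finite place** (`kodairaNeron_exists_finset_reducesToNonsingular` for the minimal models
`W.localMinimalModel v`; *ATAEC* Cor. IV.9.2(d), not proved in the book).
[cite: SilvermanATAEC1994, Thm. IV.10.2(a), additive case (PDF p. 358), with Cor. IV.9.2(d)] -/
theorem codimFixed_inertia_rationalTate_eq_two_of_hasAdditiveReductionAt_of_kodairaNeron
    (hKN : ∀ v : HeightOneSpectrum (𝓞 K),
      (W.localMinimalModel v).kodairaNeron_exists_finset_reducesToNonsingular) :
    W.codimFixed_inertia_rationalTate_eq_two_of_hasAdditiveReductionAt ℓ := by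
  intro _ h v hℓ hv 𝔓 h𝔓
  exact W.codimFixed_inertia_rationalTate_eq_two_of_hasAdditiveReductionAt_of_kodairaNeron_at ℓ
    (hKN v) h hℓ hv h𝔓

end WeierstrassCurve

end
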